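import Summits.CriticalPhenomena.PercolationContinuityZ3.Theorems.Transplant.SkelPhiInfClusterMeetsEq
import Summits.CriticalPhenomena.PercolationContinuityZ3.Theorems.Transplant.SkelPhiInfClusterMeetsQ
import HarnessLib

/-!
# WAVE-Q binder row «SkelPhiInfClusterMeetsEq» ↦ «SkelPhiInfClusterMeetsEqQ» (quasi-step rung (N3-b); captain gen-1 g4, table v0.7, R-3): **`MeetsAS` for regions holding far boxes,
# for strip complements and for co-quadrants — under EXACT-FOOTPRINT QUASI-STEPS of the chart** (`Frames` + `QStepsN N` + `Lip`)

builds on p205010 (kernel theorem, internal audit signed; external expert review pending) — nothing in this file uses p205010; nothing here is a claim about any open node.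
Lane `prim-bschramm`, seat `prim-bschramm-stmt` gen 33 (port pen).  Helper file (`--supports stmt-CriticalPhenomena-4575 --as helper`); def-free; the `Steps ↦ QStepsN` twins of
«SkelPhiInfClusterMeetsEq» §1 (the three declarations that thread `hstep`): hunk (i) `(hstep : Steps G φ) ↦ {N : ℕ} (hq : Skelφ.QStepsN G φ N)` (cost named `N` — the
statements already bind a zone scale `M`), hunk (ii) `ae_reachable_of_farBoxes hstep ↦ ae_reachable_of_farBoxesQ hq` («SkelPhiInfClusterMeetsQ»); no radius token; the Steps-free residents
`halfPlane_subset_compl_strip` / `quadrant_subset_compl_Xinf` stay imported from the original; the `PlanarSkeletonNeg` §2 instances belong to N1 and are not twinned.  Regression: `N = 1` is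
the original (`qStepsN_of_steps`).
* `meetsAS_of_farBoxesQ`, `meetsAS_compl_stripQ`, `meetsAS_compl_XinfQ`.
[cite: MartineauTassion2017, §3.1.2 Lemma 3.4; §3.2 proof of Lemma 3.5, (13) and Fact 2 (arXiv pp. 9–10)]
-/

noncomputable section

open MeasureTheory

namespace Summit.CriticalPhenomena.PercolationContinuityZ3.Theorems.Transplant

namespace Skelφ

open Literature.Probability.Percolation Literature.Probability.LatticeModels SimpleGraph

variable {V : Type} {G : SimpleGraph V} {φ : V → Site 2} {types : Finset V}

/-- **`MeetsAS` for every region holding far boxes** — quasi-step form (connected `G`, countable `V`, `Frames`/`QStepsN`/`Lip`, a.s. uniqueness at `p`).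
[cite: MartineauTassion2017, §3.1.2 Lemma 3.4 (second part; arXiv p. 9)] -/
theorem meetsAS_of_farBoxesQ [Countable V] (hc : G.Preconnected) (hfr : Frames G φ types) {N : ℕ} (hq : QStepsN G φ N) (hlip : Lip G φ) (w₀ : V)
    {p : unitInterval} (hU : ∀ᵐ ω ∂bondPercolation G p, numInfiniteClusters ω ≤ 1) {Q : Set V} (hQ : FarBoxes φ Q) : Eq.MeetsAS G p Q := by
  filter_upwards [ae_reachable_of_farBoxesQ hc hfr hq hlip w₀ hU hQ] with ω hω x hx
  obtain ⟨q, hqQ, -, hxq⟩ := hω x hx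
  exact ⟨q, hqQ, hxq⟩

/-- **`MeetsAS` for the strip complement `V ∖ Y`** — quasi-step form (Martineau–Tassion's Fact 2 input). [cite: MartineauTassion2017, §3.2 proof of Lemma 3.5, Fact 2 (arXiv p. 10)] -/
theorem meetsAS_compl_stripQ [Countable V] (hc : G.Preconnected) (hfr : Frames G φ types) {N : ℕ} (hq : QStepsN G φ N) (hlip : Lip G φ)
    {p : unitInterval} (hU : ∀ᵐ ω ∂bondPercolation G p, numInfiniteClusters ω ≤ 1) (t : V) (n : ℕ) : Eq.MeetsAS G p (Eq.strip φ t n)ᶜ :=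
  meetsAS_of_farBoxesQ hc hfr hq hlip t hU ((farBoxes_halfPlane t 0 1 ((n : ℤ) + 1)).mono (halfPlane_subset_compl_strip t n))

/-- **`MeetsAS` for the co-quadrant `V ∖ X`** — quasi-step form (Martineau–Tassion's Fact 1 input; both signs `σ`). [cite: MartineauTassion2017, §3.2 proof of Lemma 3.5, (13) (arXiv p. 10)] -/
theorem meetsAS_compl_XinfQ [Countable V] (hc : G.Preconnected) (hfr : Frames G φ types) {N : ℕ} (hq : QStepsN G φ N) (hlip : Lip G φ)
    {p : unitInterval} (hU : ∀ᵐ ω ∂bondPercolation G p, numInfiniteClusters ω ≤ 1) (t : V) {σ : ℤ} (hσ : σ = 1 ∨ σ = -1) (M : ℕ) :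
    Eq.MeetsAS G p (Eq.Xinf φ t σ M)ᶜ := by
  obtain ⟨u, rfl⟩ : ∃ u : ℤˣ, (u : ℤ) = σ := by
    rcases hσ with rfl | rfl
    · exact ⟨1, rfl⟩
    · exact ⟨-1, rfl⟩
  exact meetsAS_of_farBoxesQ hc hfr hq hlip t hU ((farBoxes_quadrant t _ _).mono (quadrant_subset_compl_Xinf t u M))

end Skelφ

end Summit.CriticalPhenomena.PercolationContinuityZ3.Theorems.Transplant

end
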